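import Literature.AlgebraicGeometry.AbelianSchemes.AbelianSchemePolarization
import Literature.AlgebraicGeometry.GroupSchemes.GroupSchemeKernel
import HarnessLib

/-!
# The kernel `ker λ ↪ A` of a finite polarisation is a finite closed subgroup subscheme (the (T3)-shape data) — sketch (O9b′)

Layer `Literature/AlgebraicGeometry/AbelianSchemes`, namespace `Literature.AlgebraicGeometry.AbelianSchemes.AbelianSchemeOver`.
THEOREMS ONLY (no definition, no named fact, no instance, no notation, no `sorry`).  Cell `hodgecm-mathlib` (D-0151), sub-desk P6b
census (O9) brick **(O9b′)**: for a polarisation `λ : A → Â` (★ `Polarization D`) with `λ` FINITE, the kernel `Ker λ = A ×_{λ, Â, ε} S`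
(★ `GroupSchemeKernel.ker`, [GortzWedhorn2020] Def. 4.45 (2)) with its inclusion `ι = kerι λ : Ker λ ↪ A` is exactly the data the
torsion bricks ★ (T3) `exists_pow_eq_one_of_formallyUnramified` / (T3′) `pow_eq_one_of_forall_order_dvd` consume: `ι` a closed immersion
(`Â → S` is separated: ★ `isClosedImmersion_kerι_left_of_isSeparated`), `Ker λ → S` finite (base change of `λ` along the unit section,
★ `isPullback_kerι_left` + Mathlib stability of `@IsFinite` under base change), the unit ∕ product ∕ inverse factorisations (★ `kerLift`
on the kernel subgroup `(IsMonHom.monoidHom λ T).ker`), and the universal property «`u ≫ λ = 1 ⇒ u` factors through `ι`» (★ `kerLift_ι`).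
HC_CM is proved only modulo the printed citations until rung 0 closes; nothing here is about HC.

## References
* [GortzWedhorn2020] U. Görtz, T. Wedhorn, *Algebraic Geometry I*, 2nd ed. (2020), Definition 4.45 (p. 117), Prop. 12.11.
* [MumfordFogartyKirwan1994] D. Mumford, J. Fogarty, F. Kirwan, *GIT*, 3rd ed. (1994), Ch. 6 §2 Prop. 6.13 (iii) (p. 123), Ch. 7 §2 Def. 7.2 (p. 129).
* [MumfordAV1970] D. Mumford, *Abelian Varieties* (1970), §13 (p. 123), §23 (p. 231).
-/

set_option autoImplicit false

noncomputable section

set_option backward.isDefEq.respectTransparency false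

open CategoryTheory CategoryTheory.Limits AlgebraicGeometry MonoidalCategory CartesianMonoidalCategory

open scoped MonObj CategoryTheory.Obj

namespace Literature.AlgebraicGeometry.AbelianSchemes

open Literature.AlgebraicGeometry.GroupSchemes Literature.AlgebraicGeometry.GroupSchemes.GroupSchemeKernel

namespace AbelianSchemeOver

universe u

variable {S : Scheme.{u}} (A : AbelianSchemeOver S) {D : A.DualPair} (pol : A.Polarization D) [IsMonHom pol.lam]

/-! ## §1 `ker λ ↪ A` is a closed immersion, finite over the base when `λ` is -/

omit [IsMonHom pol.lam] in
/-- **`Ker λ ↪ A` is a closed immersion** (the dual `Â → S` is proper, hence separated, so its unit section is a closed immersion).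
[cite: GortzWedhorn2020, Definition 4.45 (2) (p. 117)] -/
theorem Polarization.isClosedImmersion_kerι_left : IsClosedImmersion (kerι pol.lam).left := by
  haveI := D.hat.isProper
  exact isClosedImmersion_kerι_left_of_isSeparated pol.lam

omit [IsMonHom pol.lam] in
/-- **`Ker λ → S` is finite when `λ` is** (base change of `λ` along the unit section `ε_Â : S → Â`).
[cite: GortzWedhorn2020, Definition 4.45 (2) (p. 117) and Prop. 12.11] [cite: MumfordFogartyKirwan1994, Ch. 6 §2 Proposition 6.13 (iii) (p. 123)] -/
theorem Polarization.isFinite_ker_hom [IsFinite pol.lam.left] : IsFinite (ker pol.lam).hom := by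
  have hsnd : IsFinite (pullback.snd pol.lam η[D.hat.X]).left :=
    MorphismProperty.of_isPullback (P := @IsFinite) (isPullback_kerι_left pol.lam) inferInstance
  have hw : (pullback.snd pol.lam η[D.hat.X]).left ≫ (𝟙_ (Over S)).hom = (ker pol.lam).hom := Over.w _
  rw [← hw]
  haveI : IsFinite (𝟙_ (Over S)).hom := by
    change IsFinite (𝟙 S)
    infer_instance
  infer_instance

/-! ## §2 The three factorisations and the universal property -/

/-- The unit of `A` factors through `Ker λ`. [cite: GortzWedhorn2020, Definition 4.45 (2) (p. 117)] -/
theorem Polarization.exists_one_fac_kerι : ∃ e : 𝟙_ (Over S) ⟶ ker pol.lam, e ≫ kerι pol.lam = 1 :=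
  ⟨kerLift 1 (by rw [MonObj.one_comp]), kerLift_ι _ _⟩

/-- The product of the two projections `Ker λ × Ker λ → A` factors through `Ker λ`. [cite: GortzWedhorn2020, Definition 4.45 (2) (p. 117)] -/
theorem Polarization.exists_mul_fac_kerι :
    ∃ m : ker pol.lam ⊗ ker pol.lam ⟶ ker pol.lam,
      m ≫ kerι pol.lam = (fst _ _ ≫ kerι pol.lam) * (snd _ _ ≫ kerι pol.lam) := by
  have h : ((fst _ _ ≫ kerι pol.lam) * (snd _ _ ≫ kerι pol.lam)) ≫ pol.lam = 1 :=
    (mem_ker_iff pol.lam _).1 (mul_mem (comp_kerι_mem_ker pol.lam _) (comp_kerι_mem_ker pol.lam _))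
  exact ⟨kerLift _ h, kerLift_ι _ _⟩

/-- The inverse of the inclusion factors through `Ker λ`. [cite: GortzWedhorn2020, Definition 4.45 (2) (p. 117)] -/
theorem Polarization.exists_inv_fac_kerι : ∃ n : ker pol.lam ⟶ ker pol.lam, n ≫ kerι pol.lam = (kerι pol.lam)⁻¹ := by
  have h : (kerι pol.lam)⁻¹ ≫ pol.lam = 1 :=
    (mem_ker_iff pol.lam _).1 (inv_mem ((mem_ker_iff pol.lam _).2 (kerι_comp pol.lam)))
  exact ⟨kerLift _ h, kerLift_ι _ _⟩

omit [IsMonHom pol.lam] in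
/-- **A `T`-valued point of `A` killed by `λ` factors through `Ker λ ↪ A`.** [cite: GortzWedhorn2020, Definition 4.45 (2) (p. 117)] -/
theorem Polarization.exists_fac_kerι_of_comp_lam_eq_one {T : Over S} (u : T ⟶ A.X) (hu : u ≫ pol.lam = 1) :
    ∃ w : T ⟶ ker pol.lam, w ≫ kerι pol.lam = u :=
  ⟨kerLift u hu, kerLift_ι u hu⟩

/-- **Conversely**, a point through `Ker λ` is killed by `λ`. [cite: GortzWedhorn2020, Definition 4.45 (2) (p. 117)] -/
theorem Polarization.comp_kerι_comp_lam {T : Over S} (w : T ⟶ ker pol.lam) : (w ≫ kerι pol.lam) ≫ pol.lam = 1 :=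
  (mem_ker_iff pol.lam _).1 (comp_kerι_mem_ker pol.lam w)

end AbelianSchemeOver

end Literature.AlgebraicGeometry.AbelianSchemes

end
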